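import Summits.Schanuel.Schanuel.Theses.RoyCriterion
import Literature.NumberTheory.Transcendental.LindemannWeierstrassProofs

-- `Summit.Schanuel.Schanuel.…` is the mandated layout of this single-problem summit (CONVENTIONS §1).
set_option linter.dupNamespace false

/-!
# Route `RoyCriterion`, crux `SchanuelTwo` (stmt-Schanuel-0069), line `Sketch` — stub
# `stub_purityAlgebraic`: the `(E,E)` = Lindemann–Weierstrass sector

The crux is Schanuel's conjecture for `n = 2`: for `x : Fin 2 → ℂ` linearly independent over `ℚ`,
`2 ≤ trdeg_ℚ ℚ(x 0, x 1, e^{x 0}, e^{x 1})`. Line `Sketch` ("Hermite–Lindemann collapse ⟹ line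
purity") splits the crux by seed type; this file is the sector in which BOTH coordinates `x i` are
algebraic over `ℚ`. There the Lindemann–Weierstrass theorem in Weierstrass' form (Weierstrass 1885;
Baker, *Transcendental Number Theory* (1975), Ch. 1, Theorem 1.4 and the remark after it), PROVED in
tree as `Literature.NumberTheory.Transcendental.algebraicIndependent_exp_holds`, says that
`e^{x 0}, e^{x 1}` are algebraically independent over `ℚ`; both lie in the field
`ℚ(x, e^x) = IntermediateField.adjoin ℚ (range x ∪ range (exp ∘ x))`, so its transcendence degree
over `ℚ` is at least `2` (`AlgebraicIndependent.cardinalMk_le_trdeg`).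

In the lead's skeleton this discharges the `∀ i, IsAlgebraic ℚ (x i)` branch of
`linePurity_of_stubs`. No definitions, no sorry; axioms `propext`, `Classical.choice`, `Quot.sound`.
-/

noncomputable section

namespace Summit.Schanuel.Schanuel.Theorems

/-- **Purity for two algebraic seeds** (the `(E,E)` sector of line `Sketch` for crux `SchanuelTwo`):
if `x : Fin 2 → ℂ` is `ℚ`-linearly independent with both coordinates algebraic over `ℚ`, then
`2 ≤ trdeg_ℚ ℚ(x, e^x)`. Proof: by Lindemann–Weierstrass (Weierstrass' form, tree theorem
`Literature.NumberTheory.Transcendental.algebraicIndependent_exp_holds`) the pair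
`i ↦ e^{x i}` is algebraically independent over `ℚ`; it lies in `ℚ(x, e^x)`, and pulling the
algebraic independence back along the (injective) inclusion `ℚ(x, e^x) → ℂ` gives two algebraically
independent elements of `ℚ(x, e^x)`, whence `#(Fin 2) = 2 ≤ trdeg`. -/
theorem stub_purityAlgebraic :
    ∀ x : Fin 2 → ℂ, LinearIndependent ℚ x → (∀ i, IsAlgebraic ℚ (x i)) →
      (2 : Cardinal) ≤ Algebra.trdeg ℚ ↥(IntermediateField.adjoin ℚ (Set.range x ∪ Set.range (Complex.exp ∘ x))) := by
  intro x hx halg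
  have hind : AlgebraicIndependent ℚ (fun i => Complex.exp (x i)) :=
    Literature.NumberTheory.Transcendental.algebraicIndependent_exp_holds x halg hx
  let y : Fin 2 → ↥(IntermediateField.adjoin ℚ (Set.range x ∪ Set.range (Complex.exp ∘ x))) :=
    fun i => ⟨Complex.exp (x i), IntermediateField.subset_adjoin ℚ _ (Or.inr ⟨i, rfl⟩)⟩
  have hy : AlgebraicIndependent ℚ y :=
    AlgebraicIndependent.of_comp
      (IntermediateField.adjoin ℚ (Set.range x ∪ Set.range (Complex.exp ∘ x))).val hind
  simpa using hy.cardinalMk_le_trdeg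

end Summit.Schanuel.Schanuel.Theorems

end
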